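import Summits.QuantumFields.YangMills.Theorems.BalabanUVNodesN07NormalisationOfRecordWide
import Summits.QuantumFields.YangMills.Theorems.BalabanUVNodesN07SymContourData
import HarnessLib

/-!
# N07 [B11] (= [15] = [Balaban1985Variational]) Sect. F — **THE NORMALISATION OF RECORD IN THE SYMMETRIC CURRENCY** `NrmSymOfRecord`: MODULE 60′'s `NrmOfRecordWide` with the
# representative's axial tower taken for [I] (0.11)'s AVERAGED contour variables (`symContourData federbushSU`, the «Euclidean invariant axial gauge») instead of the one-path radial
# datum — cure (α″) of ⚑ LOCATED-CPRIME-CURRENCY, plan g91 RULING A3‴ («the `Nrm` TEXT OF RECORD := 60⁗ `NrmSymOfRecord`»)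

Cell `pub-ymgap`, seat `pub-ymgap-dag-n07-e` g27 (FAN-OUT §N07 row s3; LANE OWNER of the K0 road), MODULE 87 = 60⁗ (INTENT-87, cell bus).
`--kind definition --supports stmt-QuantumFields-20541 --as helper` (K0⁷); count-neutral.  ONE `def` (a displayed predicate, NEVER asserted) + by-name bookkeeping; nothing landed is
edited (60′ `NrmOfRecordWide` stays in the tree as the radial resting state, superseded BY NAME).  [15] = [Balaban1985Variational]; [3] = [Balaban1985Averaging]; [6] =
[Balaban1985RegularSpaces]; [I] = [Balaban1987RG1].

WHY (desk memo `LOCATED-CPRIME-CURRENCY.md` §2∕§5; plan RULING A3‴).  The chart half of the K0 road reads the FLAT tube averages `Q_j` (k0-s1's flat chart, 76, 82a∕82b, UST's double-bar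
linearisation); the normalisation half (60′, MODULE 80's δ-rows) read the RADIAL-sheared averages of [3] (85)∕(88) — two first-order currencies that differ by in-block curvature fluxes, with
the (c′) letter on the seam.  Print's own remedy for the SYMMETRISED averaging (0.4) of record is [I] p. 253: «a Euclidean invariant definition of the axial gauge fixing … variables obtained
by averaging the contour variables {U(Γ)}_{Γ∈G(y,x)} … (0.11)».  MODULE 86 typed (0.11) as `symContourData 𝓜 : Setup.ContourData` (exact covariance by Federbush's (0.6)); THIS FILE
re-texts the normalisation predicate with the representative `U^w` AXIAL FOR THAT DATUM below `j` — everything else (residual `w`, the rooted top gauge `h` on print's window `□̃`, the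
(78) unit-block-average conjunct `R̄^{j′}(h̄·w·u⁻¹) = 1` on the cells of `D″`) VERBATIM from 60′ — and re-derives 60′'s three readers through `Node00/ShearedAveragingFlat`'s (84)∕(88),
which are GENERIC in the contour datum: the SYMMETRIC-sheared average of the Landau copy equals the plain average of the representative, `𝒜^{sym}_{j′}(U^u)(c) = M^{j′}((U^w)^{h̄})(c)`,
at every cell bond.  (The first-order agreement of `𝒜^{sym}` with the flat tube — the point of the cure — is the separate linearisation theorem of the (α″) programme; not here.)

WHAT THIS FILE DECLARES (one definition) AND PROVES (bookkeeping; NOTHING of [15]∕[3]∕[6]∕[I] analysis).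
* §1 `symCd F N K i := symContourData federbushSU` (the (0.11) datum of record at level `i` of the torus `F.P K`, an `abbrev`) and its centre value `symCd_hctr` at EVERY level
  (in range: MODULE 86 `symContourData_federbushSU_holTo_emb`; junk levels: the radial fallback and `radialHol_emb_self`).
* §2 `NrmSymOfRecord F N Mc ρ : <MODULE 59's `Nrm` type>` — 60′ `NrmOfRecordWide` with `AxialGauge (radialContourData …)` ↦ `AxialGauge (symCd F N K i)`.
* §3 `symTower_gaugeAct_blockLift` (block-constant lifts keep a `symCd`-axial tower axial — dag-n07-w6's GENERIC `axialTower_gaugeAct_blockLift`), ★★ `shearedAvgIter_sym_landau_eq_iter_rep`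
  (60's `shearedAvgIter_landau_eq_iter_rep` at `symCd`: (88) via `ShearedAveragingRecord.shearedAvgIter_avOfRecord_eq_iter_gauge_cd`), ★★★ `NrmSymOfRecord.exists_rep`,
  ★★★ `NrmSymOfRecord.exists_top_dataAxial`, ★★ `NrmSymOfRecord.exists_rep_window` — 60′'s three readers, texts identical but for the datum letter.
HONEST SCOPE.  One displayed predicate (NEVER asserted; it DISCHARGES NOTHING) + kernel bookkeeping over LANDED theorems; its only door is the CONDITIONAL door from the named premise
`HThm4Rec` re-texted at this datum (to follow, S; N05-REC's target moves by the datum letter only, [I] p. 253 licence identical); HS3NORM ∕ HCHART-MEET-NORM ∕ HBUDGET stay displayed;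
K0⁷ ∕ K1⁹ NOT closed; N07 ∕ N05 NOT discharged; counts unmoved (typed 28∕28 · discharged 8∕27 per the chair); one finite 𝕋⁴ programme at fixed ε — the route closes the conditional
finite-𝕋⁴ rung `BalabanLadder.UV` ONLY; the YM mass gap (Clay) is NOT proved by any of this; nothing continuum ∕ ℝ⁴ ∕ OS.  ONE `def` + one `abbrev`, no `instance`, no `notation`, no `sorry`.

References: [I] (0.3) p. 252, (0.5)–(0.11) p. 253; [15] (144) p. 300, (147) p. 301, (150)–(154) pp. 301–302; [3] (78)–(81) p. 30, (84)–(88) p. 31; [6] (1.15) p. 78, (1.29) p. 81, p. 98.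
-/

set_option autoImplicit false

noncomputable section

namespace Summit.QuantumFields.YangMills.BalabanUVNodes.N07NormalisationSymOfRecord

open Literature.MathematicalPhysics.QuantumFieldTheory.Balaban1983to89
open Literature.MathematicalPhysics.QuantumFieldTheory.Balaban1983to89.Node00
open T4Continuum (T4Family)
open T4AxialGaugeSmallField (castSite)
open T4AxialGaugeRooted (axialGaugeAt)
open B12GaugeOrbits021 (IsResidual)
open B15Eq177GaugeInvariance (blockLift)
open B14DomainGeom (Pt)
open B8Ineq130 (tlo thi)
open B8Eq131Cubes (tLo tHi ctr)
open B6SectADomainsV1 (Domains)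
open GaugeField (gaugeAct)
open ExpMeanLog (expMeanLogSU)
open Summit.QuantumFields.Balaban3D.Carriers (radialHol)
open Summit.QuantumFields.YangMills.BalabanUVNodes.N07SymContourData (symContourData symContourData_federbushSU_holTo_emb symContourData_holTo_of_not_range)
open Summit.QuantumFields.YangMills.BalabanUVNodes.N07AxialTowerRepresentative (axialTower_gaugeAct_blockLift)
open Summit.QuantumFields.YangMills.BalabanUVNodes.N07RadialAxialTower (radialHol_emb_self)
open Summit.QuantumFields.YangMills.BalabanUVNodes.N07NormalisationOfRecord (gaugeAct_rep_of_landau)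
open Summit.QuantumFields.YangMills.BalabanUVNodes.N09AxialSelectionExists (iter_gaugeAct_blockLift)
open Summit.QuantumFields.YangMills.BalabanUVNodes.N07CubeTowerUnderPrintWindow (lamSite_domainsMeet_cubeDomains_mem_tcubeWindow)

/-! ## §1  The (0.11) datum of record and its centre value -/

/-- **THE AVERAGED CONTOUR DATUM OF RECORD** at level `i` of the torus `F.P K`: MODULE 86's `symContourData` for Federbush's mean (0.10) on `SU(N)` ([I] (0.11) «U(y,x) = M({U(Γ)}_{Γ∈G(y,x)})»).
[cite: Balaban1987RG1, (0.10)–(0.11) p.253] -/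
abbrev symCd (F : T4Family) (N : ℕ) [NeZero N] (K i : ℕ) : ContourData (F.P K) i (SU N) :=
  symContourData (FederbushMean.federbushSU (n := Fin N))

/-- The centre value of the datum of record is `1` at EVERY level (in the standing range by `federbushSU_const`, at junk levels by the radial fallback) — the hypothesis `hctr` of
`Node00/ShearedAveragingFlat`'s (82)–(88). [cite: Balaban1987RG1, (0.11) p.253; Balaban1985Averaging, (82) p.30] -/
theorem symCd_hctr (F : T4Family) (N : ℕ) [NeZero N] (K : ℕ) :
    ∀ (i : ℕ) (U : GaugeField (F.P K) i (SU N)) (y : Site (F.P K) (i + 1)), (symCd F N K i).holTo U y (emb y) = 1 := by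
  intro i U y
  by_cases hi : i + 1 ≤ (F.P K).m + (F.P K).K
  · exact symContourData_federbushSU_holTo_emb hi U y
  · rw [symCd, symContourData_holTo_of_not_range _ hi]
    exact radialHol_emb_self U y

/-! ## §2  The definition -/

/-- **THE NORMALISATION OF RECORD IN THE SYMMETRIC CURRENCY** — MODULE 60′'s `NrmOfRecordWide` VERBATIM except that the representative `U^w` is axial below `j` for the AVERAGED contour
datum `symCd` of [I] (0.11) (the «Euclidean invariant axial gauge») instead of the one-path radial datum: for the datum `(j, idx)`, the minimiser `U` and S3's gauge `u`, there is a
residual `w` of level `j` with `M^i(U^w)` `symCd`-axial for `i < j` such that `g = h̄·w·u⁻¹` — `h` the top axial gauge of `M^j(U^w)` on print's window `□̃` rooted at its centre —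
has unit block averages `R̄^{j′}g = 1` ([3] (78)–(81)) on every cell site `Λ′_{j′}(D″)`, `j′ ≤ j`, `D″ = cubeDomains ⊓ record`.  A displayed predicate, NEVER asserted.
[cite: Balaban1987RG1, (0.11) p.253; Balaban1985Variational, (144) p.300, (147) p.301, (150)–(154) pp.301–302; Balaban1985Averaging, (78)–(81) p.30; Balaban1985RegularSpaces, (1.15) p.78, (1.29) p.81] -/
def NrmSymOfRecord (F : T4Family) (N : ℕ) [NeZero N] (Mc ρ : ℕ) :
    ∀ (ν : Stage7Numerics) (M : ℕ) (g : ℕ → ℝ) (K k : ℕ), SeqOfRecord F ν M g K k → GaugeField (F.P K) 0 (SU N) → ℕ → Pt (F.P K).d →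
      GaugeTransf (F.P K) 0 (SU N) → (PBond (F.P K) 0 → MatA N) → Prop :=
  fun _ν _M _g K _k s U j idx u _A =>
    ∃ w : GaugeTransf (F.P K) 0 (SU N), IsResidual j w ∧
      (∀ i < j, AxialGauge (symCd F N K i) (Averaging.iter (avOfRecord F N K) i (gaugeAct w U))) ∧
      ∀ (hk : j ≤ (F.P K).m + (F.P K).K) (j' : ℕ), j' ≤ j → ∀ y : Site (F.P K) j',
        (domainsMeet (cubeDomains (F.P K) (cornerP (F.P K) Mc ρ idx) (sideP (F.P K) Mc ρ) ρ j hk) (domainsOfSeq s.Ω j hk)).LamSite j' y →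
          gaugeAvgIter (loopAvgBlockOp expMeanLogSU)
              (fun x => blockLift j (axialGaugeAt (Averaging.iter (avOfRecord F N K) j (gaugeAct w U))
                  (tLo (cornerP (F.P K) Mc ρ idx) ρ) (tHi (cornerP (F.P K) Mc ρ idx) (sideP (F.P K) Mc ρ) ρ) (ctr (cornerP (F.P K) Mc ρ idx) (sideP (F.P K) Mc ρ))) x *
                w x * (u x)⁻¹) j' y = 1

/-! ## §3  (154)₁ in the symmetric currency, derived by name -/

section Derived

variable (F : T4Family) (N : ℕ) [NeZero N]

/-- Block-constant lifts keep a `symCd`-axial tower axial (dag-n07-w6's GENERIC `axialTower_gaugeAct_blockLift` at the (0.11) datum).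
[cite: Balaban1985RegularSpaces, (1.15) p.78; Balaban1987RG1, (0.11) p.253] -/
theorem symTower_gaugeAct_blockLift (K : ℕ) {j : ℕ} (hj : j ≤ (F.P K).m + (F.P K).K) (h : GaugeTransf (F.P K) j (SU N)) (U' : GaugeField (F.P K) 0 (SU N))
    (hax : ∀ i < j, AxialGauge (symCd F N K i) (Averaging.iter (avOfRecord F N K) i U')) :
    ∀ i < j, AxialGauge (symCd F N K i) (Averaging.iter (avOfRecord F N K) i (gaugeAct (blockLift j h) U')) :=
  axialTower_gaugeAct_blockLift (avOfRecord F N K) (fun i => symCd F N K i) j hj h U' hax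

/-- ★★ **(154)₁ IN THE SYMMETRIC CURRENCY, generic in the witness** (MODULE 60's `shearedAvgIter_landau_eq_iter_rep` at the (0.11) datum): `U′ = U^{w}` `symCd`-axial below `j ≤ m + K`,
`h` any coarse gauge of level `j`, `g = h̄·w·u⁻¹`; at a bond `c` of `T^{(j′)}`, `j′ ≤ j`, with `R̄^{j′}g = 1` at both ends, the SYMMETRIC-sheared average of the Landau copy equals the
plain average of the representative: `𝒜^{sym}_{j′}(U^u)(c) = M^{j′}((U′)^{h̄})(c)` ([3] (88) through `ShearedAveragingRecord.shearedAvgIter_avOfRecord_eq_iter_gauge_cd`, `hctr` = §1).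
[cite: Balaban1985Variational, (154) p.302; Balaban1985Averaging, (88) p.31; Balaban1987RG1, (0.11) p.253] -/
theorem shearedAvgIter_sym_landau_eq_iter_rep (K : ℕ) {j : ℕ} (hj : j ≤ (F.P K).m + (F.P K).K) {U : GaugeField (F.P K) 0 (SU N)} {w : GaugeTransf (F.P K) 0 (SU N)}
    (hax : ∀ i < j, AxialGauge (symCd F N K i) (Averaging.iter (avOfRecord F N K) i (gaugeAct w U)))
    (h : GaugeTransf (F.P K) j (SU N)) (u : GaugeTransf (F.P K) 0 (SU N)) {j' : ℕ} (hj' : j' ≤ j) {c : PBond (F.P K) j'}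
    (hsrc : gaugeAvgIter (loopAvgBlockOp expMeanLogSU) (fun x => blockLift j h x * w x * (u x)⁻¹) j' c.src = 1)
    (htgt : gaugeAvgIter (loopAvgBlockOp expMeanLogSU) (fun x => blockLift j h x * w x * (u x)⁻¹) j' c.tgt = 1) :
    shearedAvgIter (avOfRecord F N K) (fun i => symCd F N K i) (loopAvgBlockOp expMeanLogSU) (gaugeAct u U) j' c =
      Averaging.iter (avOfRecord F N K) j' (gaugeAct (blockLift j h) (gaugeAct w U)) c := by
  have hj'K : j' ≤ (F.P K).m + (F.P K).K := hj'.trans hj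
  have hax' : ∀ i < j', AxialGauge (symCd F N K i)
      (Averaging.iter (avOfRecord F N K) i (gaugeAct (fun x => blockLift j h x * w x * (u x)⁻¹) (gaugeAct u U))) := by
    rw [gaugeAct_rep_of_landau]
    exact fun i hi => symTower_gaugeAct_blockLift F N K hj h _ hax i (lt_of_lt_of_le hi hj')
  rw [shearedAvgIter_avOfRecord_eq_iter_gauge_cd F N K (fun i => symCd F N K i) (symCd_hctr F N K) hj'K hax' hsrc htgt, gaugeAct_rep_of_landau]

variable {F N}

/-- ★★★ **(154)₁ READ OFF `NrmSymOfRecord`**: for the witness `w` and every bond `c` of `T^{(j′)}`, `j′ ≤ j`, whose two ends are cell sites of `D″`,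
`𝒜^{sym}_{j′}(U^{u})(c) = M^{j′}((U^{w})^{h̄})(c)`, `h` the rooted top gauge of the level-`j` data on `□̃`. [cite: Balaban1985Variational, (150)–(154) pp.301–302; Balaban1985Averaging, (88) p.31; Balaban1987RG1, (0.11) p.253] -/
theorem NrmSymOfRecord.exists_rep {Mc ρ : ℕ} {ν : Stage7Numerics} {M : ℕ} {g : ℕ → ℝ} {K k : ℕ}
    {s : SeqOfRecord F ν M g K k} {U : GaugeField (F.P K) 0 (SU N)} {j : ℕ} {idx : Pt (F.P K).d} {u : GaugeTransf (F.P K) 0 (SU N)}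
    {A : PBond (F.P K) 0 → MatA N} (hN : NrmSymOfRecord F N Mc ρ ν M g K k s U j idx u A) (hk : j ≤ (F.P K).m + (F.P K).K) :
    ∃ w : GaugeTransf (F.P K) 0 (SU N), IsResidual j w ∧
      (∀ i < j, AxialGauge (symCd F N K i) (Averaging.iter (avOfRecord F N K) i (gaugeAct w U))) ∧
      ∀ (j' : ℕ) (_ : j' ≤ j) (c : PBond (F.P K) j'),
        (domainsMeet (cubeDomains (F.P K) (cornerP (F.P K) Mc ρ idx) (sideP (F.P K) Mc ρ) ρ j hk) (domainsOfSeq s.Ω j hk)).LamSite j' c.src →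
        (domainsMeet (cubeDomains (F.P K) (cornerP (F.P K) Mc ρ idx) (sideP (F.P K) Mc ρ) ρ j hk) (domainsOfSeq s.Ω j hk)).LamSite j' c.tgt →
          shearedAvgIter (avOfRecord F N K) (fun i => symCd F N K i) (loopAvgBlockOp expMeanLogSU) (gaugeAct u U) j' c =
            Averaging.iter (avOfRecord F N K) j'
              (gaugeAct (blockLift j (axialGaugeAt (Averaging.iter (avOfRecord F N K) j (gaugeAct w U))
                (tLo (cornerP (F.P K) Mc ρ idx) ρ) (tHi (cornerP (F.P K) Mc ρ idx) (sideP (F.P K) Mc ρ) ρ) (ctr (cornerP (F.P K) Mc ρ idx) (sideP (F.P K) Mc ρ))))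
                (gaugeAct w U)) c := by
  obtain ⟨w, hres, hax, hnorm⟩ := hN
  exact ⟨w, hres, hax, fun j' hj' c hs ht =>
    shearedAvgIter_sym_landau_eq_iter_rep F N K hk hax _ u hj' (hnorm hk j' hj' c.src hs) (hnorm hk j' hj' c.tgt ht)⟩

/-- ★★★ **THE TOP LEVEL READ OFF `NrmSymOfRecord`**: on print's top cells, `𝒜^{sym}_j(U^{u})(c) = (V^h)(c)` with `V = M^j(U^w) = M^j(U)` (`w` residual) and `h` the top axial gauge on
`□̃` rooted at its centre — the two-sided top rows of `T4AxialGaugeRooted` ∕ MODULE 62 apply to `V^h` UNCHANGED (the top datum does not see the contour datum below `j`).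
[cite: Balaban1985Variational, (147) p.301, (154) p.302, (160) p.303; Balaban1985Averaging, (88) p.31] -/
theorem NrmSymOfRecord.exists_top_dataAxial {Mc ρ : ℕ} {ν : Stage7Numerics} {M : ℕ} {g : ℕ → ℝ} {K k : ℕ}
    {s : SeqOfRecord F ν M g K k} {U : GaugeField (F.P K) 0 (SU N)} {j : ℕ} {idx : Pt (F.P K).d} {u : GaugeTransf (F.P K) 0 (SU N)}
    {A : PBond (F.P K) 0 → MatA N} (hN : NrmSymOfRecord F N Mc ρ ν M g K k s U j idx u A) (hk : j ≤ (F.P K).m + (F.P K).K) :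
    ∃ w : GaugeTransf (F.P K) 0 (SU N), IsResidual j w ∧
      (∀ i < j, AxialGauge (symCd F N K i) (Averaging.iter (avOfRecord F N K) i (gaugeAct w U))) ∧
      Averaging.iter (avOfRecord F N K) j (gaugeAct w U) = Averaging.iter (avOfRecord F N K) j U ∧
      ∀ c : PBond (F.P K) j,
        (domainsMeet (cubeDomains (F.P K) (cornerP (F.P K) Mc ρ idx) (sideP (F.P K) Mc ρ) ρ j hk) (domainsOfSeq s.Ω j hk)).LamSite j c.src →
        (domainsMeet (cubeDomains (F.P K) (cornerP (F.P K) Mc ρ idx) (sideP (F.P K) Mc ρ) ρ j hk) (domainsOfSeq s.Ω j hk)).LamSite j c.tgt →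
          shearedAvgIter (avOfRecord F N K) (fun i => symCd F N K i) (loopAvgBlockOp expMeanLogSU) (gaugeAct u U) j c =
            gaugeAct (axialGaugeAt (Averaging.iter (avOfRecord F N K) j U)
                (tLo (cornerP (F.P K) Mc ρ idx) ρ) (tHi (cornerP (F.P K) Mc ρ idx) (sideP (F.P K) Mc ρ) ρ) (ctr (cornerP (F.P K) Mc ρ idx) (sideP (F.P K) Mc ρ)))
              (Averaging.iter (avOfRecord F N K) j U) c := by
  obtain ⟨w, hres, hax, hnorm⟩ := hN
  have hV : Averaging.iter (avOfRecord F N K) j (gaugeAct w U) = Averaging.iter (avOfRecord F N K) j U :=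
    B12GaugeOrbits021.iter_gaugeAct_of_isResidual (avOfRecord F N K) hk hres U
  refine ⟨w, hres, hax, hV, fun c hs ht => ?_⟩
  rw [← hV, shearedAvgIter_sym_landau_eq_iter_rep F N K hk hax _ u le_rfl (hnorm hk j le_rfl c.src hs) (hnorm hk j le_rfl c.tgt ht),
    iter_gaugeAct_blockLift (avOfRecord F N K) hk _ (gaugeAct w U)]

/-- ★★ **(154)₁ AT EVERY CELL BOND OF A POSITIVE LEVEL, WITH BOTH ENDS IN THE BLOW-DOWN WINDOW OF `□̃`** (`1 ≤ ρ`): the symmetric twin of 60′ `NrmOfRecordWide.exists_rep_window` — for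
`1 ≤ j′ ≤ j` and a bond `c` of `T^{(j′)}` whose ends are cell sites of `D″`, `𝒜^{sym}_{j′}(U^{u})(c) = M^{j′}((U^{w})^{h̄})(c)` AND `c.src, c.tgt ∈ castSite ″ [tlo L (tLo a ρ) (j − j′),
thi L (tHi a M ρ) (j − j′)]` (MODULE 73 §3). [cite: Balaban1985Variational, (144) p.300, (150)–(154) pp.301–302; Balaban1985RegularSpaces, p.98, (1.131) p.99] -/
theorem NrmSymOfRecord.exists_rep_window {Mc ρ : ℕ} (hρ : 1 ≤ ρ) {ν : Stage7Numerics} {M : ℕ} {g : ℕ → ℝ} {K k : ℕ}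
    {s : SeqOfRecord F ν M g K k} {U : GaugeField (F.P K) 0 (SU N)} {j : ℕ} {idx : Pt (F.P K).d} {u : GaugeTransf (F.P K) 0 (SU N)}
    {A : PBond (F.P K) 0 → MatA N} (hN : NrmSymOfRecord F N Mc ρ ν M g K k s U j idx u A) (hk : j ≤ (F.P K).m + (F.P K).K) :
    ∃ w : GaugeTransf (F.P K) 0 (SU N), IsResidual j w ∧
      (∀ i < j, AxialGauge (symCd F N K i) (Averaging.iter (avOfRecord F N K) i (gaugeAct w U))) ∧
      ∀ (j' : ℕ) (_ : 1 ≤ j') (_ : j' ≤ j) (c : PBond (F.P K) j'),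
        (domainsMeet (cubeDomains (F.P K) (cornerP (F.P K) Mc ρ idx) (sideP (F.P K) Mc ρ) ρ j hk) (domainsOfSeq s.Ω j hk)).LamSite j' c.src →
        (domainsMeet (cubeDomains (F.P K) (cornerP (F.P K) Mc ρ idx) (sideP (F.P K) Mc ρ) ρ j hk) (domainsOfSeq s.Ω j hk)).LamSite j' c.tgt →
          c.src ∈ (castSite '' Set.Icc (tlo (F.P K).L (tLo (cornerP (F.P K) Mc ρ idx) ρ) (j - j'))
              (thi (F.P K).L (tHi (cornerP (F.P K) Mc ρ idx) (sideP (F.P K) Mc ρ) ρ) (j - j')) : Set (Site (F.P K) j')) ∧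
          c.tgt ∈ (castSite '' Set.Icc (tlo (F.P K).L (tLo (cornerP (F.P K) Mc ρ idx) ρ) (j - j'))
              (thi (F.P K).L (tHi (cornerP (F.P K) Mc ρ idx) (sideP (F.P K) Mc ρ) ρ) (j - j')) : Set (Site (F.P K) j')) ∧
          shearedAvgIter (avOfRecord F N K) (fun i => symCd F N K i) (loopAvgBlockOp expMeanLogSU) (gaugeAct u U) j' c =
            Averaging.iter (avOfRecord F N K) j'
              (gaugeAct (blockLift j (axialGaugeAt (Averaging.iter (avOfRecord F N K) j (gaugeAct w U))
                (tLo (cornerP (F.P K) Mc ρ idx) ρ) (tHi (cornerP (F.P K) Mc ρ idx) (sideP (F.P K) Mc ρ) ρ) (ctr (cornerP (F.P K) Mc ρ idx) (sideP (F.P K) Mc ρ))))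
                (gaugeAct w U)) c := by
  obtain ⟨w, hres, hax, hrep⟩ := hN.exists_rep hk
  refine ⟨w, hres, hax, fun j' hj1 hj' c hs ht => ⟨?_, ?_, hrep j' hj' c hs ht⟩⟩
  · exact lamSite_domainsMeet_cubeDomains_mem_tcubeWindow hρ _ hj1 hj' hs
  · exact lamSite_domainsMeet_cubeDomains_mem_tcubeWindow hρ _ hj1 hj' ht

end Derived

end Summit.QuantumFields.YangMills.BalabanUVNodes.N07NormalisationSymOfRecord

end
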